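import Literature.AlgebraicGeometry.Resolution.ValuedFunctionFieldsLemmas
import Mathlib.Algebra.Polynomial.Taylor
import Mathlib.Algebra.Polynomial.HasseDeriv
import HarnessLib

/-!
# Kaplansky approximation and smooth uniformization of immediate rational function fields (Knaf–Kuhlmann 2009, Lemmas 2.5, 2.18, 3.9)

Topic: `Literature/AlgebraicGeometry/Resolution`. A PROVED leaf in the decomposition of the
named fact `KnafKuhlmann2009_Thm11` (Knaf–Kuhlmann 2009, Thm. 1.1;
`FiniteExtensionUniformization.lean`): the case `n = 1` of its proof rests on Prop. 3.10
("immediate valued function fields of transcendence degree 1 over a separably tame field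
are strongly smoothly `O_K`-uniformizable"), which is Thm. 3.8 (henselian rationality,
[K8]) + Lemma 3.9 (this file) + Lemma 3.7 (2) / Cor. 3.6 (`isSmoothlyUniformizableIn_of_inertial`,
`AbhyankarInertialGeneration.lean`). Lemma 3.9 in turn is Kaplansky approximation,
Lemma 2.18, whose hypothesis is condition (3) of Lemma 2.17 (Kaplansky–Kuhlmann; taken here
as a hypothesis).

* `coeff_hasseDeriv_mem`, `coeff_taylor_mem`, `exists_polynomial_eval_eq_of_mem_closure` —
  PROVED bookkeeping: Hasse derivatives / Taylor coefficients of polynomials over a subfield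
  `K`, and `K[z] = {P(z)}`.
* `exists_valuation_sub_lt` — PROVED, **Lemma 2.5**: for `K(z)|K` immediate and `z ∉ K` the
  values `v(z - a)`, `a ∈ K`, have no maximum.
* `exists_center_taylor_valuation_ne` — PROVED, **Lemma 2.18**: under condition (3), for
  finitely many polynomials `f` over `K` there are `a, b ∈ K` with `v(b) = v(z - a)` such that
  the non-zero Taylor terms `f^{[i]}(a) bⁱ` have pairwise distinct values.
* `exists_dominant_taylor_term` — PROVED, formula (4)/(10): then `f(z) = t · f̃(z̃)`,
  `z̃ = (z - a)/b`, `t ∈ K`, `f̃ ∈ O_K[X]`, `v(f̃(z̃)) = 0`.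
* `isSmoothlyUniformizableIn_of_immediate_of_kaplansky` — PROVED, **Lemma 3.9**: if
  `K(z)|K` is immediate, `z` transcendental over `K`, and condition (3) holds, then every
  finite `Z ⊆ O_{K(z)}` is smoothly `O_K`-uniformizable, on the polynomial model `O_K[z̃]`.

## Source

* H. Knaf, F.-V. Kuhlmann, *Every place admits local uniformization in a finite extension of
  the function field*, Adv. Math. 221 (2009) 428–453 = arXiv:math/0702856v1: Lemma 2.5
  (p. 8), §2.4, Lemmas 2.17, 2.18 (pp. 12–13), Lemma 3.9 (pp. 18–19). Pages refer to the
  arXiv PDF.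

## Rendering notes

Ambient form as in `ValuedFunctionFields.lean`: `(Ω, V)` a valued field, `K : Subfield Ω`,
`K(z) = Subfield.closure (K ∪ {z})`, `O_K = V ∩ K` (the base ring `↥(V.toSubring ⊓ K.toSubring)`
of `IsSmoothlyUniformizableIn`); polynomials "over `K`" are polynomials over `Ω` with
coefficients in `K`; "`K(z)|K` immediate" ↦ every non-zero element of `K(z)` has the value
of an element of `K` and every element of `O_{K(z)}` is congruent to an element of `K`
modulo the maximal ideal; "`z` transcendental over `K`" ↦ no non-zero polynomial over `K`
vanishes at `z`; the balls `B(z, β)` of condition (3) ↦ `{a ∈ K : v(z - a) ≥ v(z - a₀)}` for a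
centre `a₀ ∈ K` (the non-vacuous reading of (3)); values are written multiplicatively
(`V.valuation`, so "`≥`" of the paper is `≤`).
-/

noncomputable section

namespace Literature.AlgebraicGeometry.Resolution

universe u

open Polynomial

variable {Ω : Type u} [Field Ω] (V : ValuationSubring Ω) (K : Subfield Ω)

/-! ## Polynomials with coefficients in a subfield -/

/-- Hasse derivatives preserve "coefficients in `K`". [folklore] -/
theorem coeff_hasseDeriv_mem {f : Polynomial Ω} (hf : ∀ k, f.coeff k ∈ K) (i n : ℕ) :
    (hasseDeriv i f).coeff n ∈ K := by
  rw [hasseDeriv_coeff]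
  exact mul_mem (by exact_mod_cast natCast_mem K _) (hf _)

/-- Taylor coefficients at a point of `K` of a polynomial with coefficients in `K` lie in
`K`. [folklore] -/
theorem coeff_taylor_mem {f : Polynomial Ω} (hf : ∀ k, f.coeff k ∈ K) {a : Ω} (ha : a ∈ K)
    (i : ℕ) : (taylor a f).coeff i ∈ K := by
  rw [taylor_coeff, eval_eq_sum_range]
  exact sum_mem fun n _ => mul_mem (coeff_hasseDeriv_mem K hf i n) (pow_mem ha n)

/-! ## Immediate transcendental elements: the values `v(z - a)` have no maximum
(Knaf–Kuhlmann 2009, Lemma 2.5) -/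

/-- **Knaf–Kuhlmann 2009, Lemma 2.5** (Kaplansky): if `K(z)|K` is immediate and `z ∉ K`, then
for every `a₀ ∈ K` there is `a₁ ∈ K` with `v(z - a₁) > v(z - a₀)` (closer): write
`v(z - a₀) = v(b)`, `b ∈ K`, take `c ∈ K` with the residue of `(z - a₀)/b`, and put
`a₁ := a₀ + bc`. [cite: KnafKuhlmann2009, Lemma 2.5] -/
theorem exists_valuation_sub_lt {z : Ω} (hzK : z ∉ K)
    (hval : ∀ w ∈ Subfield.closure ((K : Set Ω) ∪ {z}), w ≠ 0 → ∃ b ∈ K,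
      V.valuation w = V.valuation b)
    (hres : ∀ w ∈ Subfield.closure ((K : Set Ω) ∪ {z}), w ∈ V → ∃ c ∈ K,
      V.valuation (w - c) < 1)
    {a₀ : Ω} (ha₀ : a₀ ∈ K) :
    ∃ a₁ ∈ K, V.valuation (z - a₁) < V.valuation (z - a₀) := by
  set E := Subfield.closure ((K : Set Ω) ∪ {z}) with hE
  have hKE : ∀ x ∈ K, x ∈ E := fun x hx => Subfield.subset_closure (Or.inl hx)
  have hzE : z ∈ E := Subfield.subset_closure (Or.inr rfl)
  have hza₀ : z - a₀ ≠ 0 := fun h => hzK (by rw [sub_eq_zero.mp h]; exact ha₀)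
  obtain ⟨b, hbK, hvb⟩ := hval (z - a₀) (sub_mem hzE (hKE a₀ ha₀)) hza₀
  have hb0 : b ≠ 0 := by
    rintro rfl
    rw [map_zero, map_eq_zero] at hvb
    exact hza₀ hvb
  have hvb0 : V.valuation b ≠ 0 := (_root_.map_ne_zero _).mpr hb0
  set w := (z - a₀) / b with hw
  have hwE : w ∈ E := div_mem (sub_mem hzE (hKE a₀ ha₀)) (hKE b hbK)
  have hvw : V.valuation w = 1 := by
    rw [hw, map_div₀, hvb, div_self hvb0]
  have hwV : w ∈ V := (V.valuation_le_one_iff w).mp hvw.le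
  obtain ⟨c, hcK, hvc⟩ := hres w hwE hwV
  refine ⟨a₀ + b * c, add_mem ha₀ (mul_mem hbK hcK), ?_⟩
  have : z - (a₀ + b * c) = b * (w - c) := by
    rw [hw]; field_simp; ring
  rw [this, map_mul]
  calc V.valuation b * V.valuation (w - c) < V.valuation b * 1 :=
        mul_lt_mul_of_pos_left hvc (zero_lt_iff.mpr hvb0)
    _ = V.valuation (z - a₀) := by rw [mul_one, hvb]

/-! ## Kaplansky approximation (Knaf–Kuhlmann 2009, Lemma 2.18) -/

/-- **Knaf–Kuhlmann 2009, Lemma 2.18** ("Let `(K(z)|K, P)` be an immediate transcendental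
extension such that condition (3) holds. Then for every polynomial `f ∈ K[z]` there exist
`a, b ∈ K` such that the values of the non-zero among the elements `f^{[i]}(a) bⁱ` are
pairwise distinct and `v z̃ = 0` for `z̃ := (z - a)/b`. … If finitely many polynomials in
`K[z]` are given, then `a, b` can be chosen such that (4) holds simultaneously for all of
them."), for a finite set `S` of polynomials. Condition (3) of Lemma 2.17 is the hypothesis
`h3`: for every polynomial `g` over `K` the value `v g(a)` is constant on a ball
`{a ∈ K : v(z - a) ≥ v(z - a₀)}` around `z`. Here `f^{[i]}` is the `i`-th Hasse derivative
and `f^{[i]}(a)` the `i`-th Taylor coefficient of `f` at `a` (Mathlib's `taylor`). PROVED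
(the bad values `γ = v(z - a)`, those with `αᵢ γⁱ = αⱼ γʲ` for some `i ≠ j`, are finitely
many, while by Lemma 2.5 infinitely many values `v(z - a)` are available).
[cite: KnafKuhlmann2009, Lemma 2.18] -/
theorem exists_center_taylor_valuation_ne {z : Ω} (hzK : z ∉ K)
    (hval : ∀ w ∈ Subfield.closure ((K : Set Ω) ∪ {z}), w ≠ 0 → ∃ b ∈ K,
      V.valuation w = V.valuation b)
    (hres : ∀ w ∈ Subfield.closure ((K : Set Ω) ∪ {z}), w ∈ V → ∃ c ∈ K,
      V.valuation (w - c) < 1)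
    (h3 : ∀ g : Polynomial Ω, (∀ k, g.coeff k ∈ K) → ∃ a₀ ∈ K, ∃ α : V.ValueGroup,
      ∀ a ∈ K, V.valuation (z - a) ≤ V.valuation (z - a₀) → V.valuation (g.eval a) = α)
    (S : Finset (Polynomial Ω)) (hS : ∀ f ∈ S, ∀ k, f.coeff k ∈ K) :
    ∃ a ∈ K, ∃ b ∈ K, b ≠ 0 ∧ V.valuation b = V.valuation (z - a) ∧
      ∀ f ∈ S, ∀ i j : ℕ, i ≠ j → (taylor a f).coeff i * b ^ i ≠ 0 →
        (taylor a f).coeff j * b ^ j ≠ 0 →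
        V.valuation ((taylor a f).coeff i * b ^ i) ≠ V.valuation ((taylor a f).coeff j * b ^ j) := by
  classical
  set E := Subfield.closure ((K : Set Ω) ∪ {z}) with hE
  have hKE : ∀ x ∈ K, x ∈ E := fun x hx => Subfield.subset_closure (Or.inl hx)
  have hzE : z ∈ E := Subfield.subset_closure (Or.inr rfl)
  have hza : ∀ a ∈ K, z - a ≠ 0 := fun a ha h => hzK (by rw [sub_eq_zero.mp h]; exact ha)
  have hvza : ∀ a ∈ K, V.valuation (z - a) ≠ 0 := fun a ha => (_root_.map_ne_zero _).mpr (hza a ha)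
  -- the Hasse derivatives of the members of `S` and their constants from (3)
  let G : Finset (Polynomial Ω) :=
    S.biUnion fun f => (Finset.range (f.natDegree + 1)).image fun i => hasseDeriv i f
  have hG : ∀ g ∈ G, ∀ k, g.coeff k ∈ K := by
    intro g hg k
    simp only [G, Finset.mem_biUnion, Finset.mem_image] at hg
    obtain ⟨f, hf, i, -, rfl⟩ := hg
    exact coeff_hasseDeriv_mem K (hS f hf) i k
  have h3' : ∀ g : Polynomial Ω, ∃ a₀ : Ω, ∃ α : V.ValueGroup, (∀ k, g.coeff k ∈ K) →
      a₀ ∈ K ∧ ∀ a ∈ K, V.valuation (z - a) ≤ V.valuation (z - a₀) →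
        V.valuation (g.eval a) = α := by
    intro g
    by_cases hg : ∀ k, g.coeff k ∈ K
    · obtain ⟨a₀, ha₀, α, h⟩ := h3 g hg
      exact ⟨a₀, α, fun _ => ⟨ha₀, h⟩⟩
    · exact ⟨0, 1, fun h => (hg h).elim⟩
  choose ctr α hctr using h3'
  -- a common centre `aS` for all `g ∈ G`
  obtain ⟨aS, haSK, haS⟩ : ∃ aS ∈ K, ∀ g ∈ G, V.valuation (z - aS) ≤ V.valuation (z - ctr g) := by
    by_cases hGne : G.Nonempty
    · obtain ⟨g₀, hg₀, hmin⟩ :=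
        Finset.exists_min_image G (fun g => V.valuation (z - ctr g)) hGne
      exact ⟨ctr g₀, (hctr g₀ (hG g₀ hg₀)).1, fun g hg => hmin g hg⟩
    · refine ⟨0, K.zero_mem, fun g hg => (hGne ⟨g, hg⟩).elim⟩
  have hconst : ∀ g ∈ G, ∀ a ∈ K, V.valuation (z - a) ≤ V.valuation (z - aS) →
      V.valuation (g.eval a) = α g := fun g hg a ha hle =>
    (hctr g (hG g hg)).2 a ha (hle.trans (haS g hg))
  -- the finitely many bad values
  let bad : Set V.ValueGroup :=
    ⋃ g ∈ G, ⋃ g' ∈ G, ⋃ p ∈ (Finset.range (G.sup natDegree + 2)) ×ˢ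
      (Finset.range (G.sup natDegree + 2)),
      {γ | γ ≠ 0 ∧ α g ≠ 0 ∧ α g' ≠ 0 ∧ p.1 ≠ p.2 ∧ α g * γ ^ p.1 = α g' * γ ^ p.2}
  have hbadfin : bad.Finite := by
    refine Set.Finite.biUnion G.finite_toSet fun g _ => ?_
    refine Set.Finite.biUnion G.finite_toSet fun g' _ => ?_
    refine Set.Finite.biUnion (Finset.finite_toSet _) fun p _ => ?_
    refine Set.Subsingleton.finite ?_
    rintro γ₁ ⟨h10, hα, hα', hp, h1⟩ γ₂ ⟨h20, -, -, -, h2⟩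
    -- `α γ^i = α' γ^j` with `i ≠ j` determines `γ ≠ 0`
    rcases Nat.lt_or_gt_of_ne hp with hij | hij
    · obtain ⟨n, hn⟩ : ∃ n, p.2 = p.1 + n := ⟨p.2 - p.1, by omega⟩
      have hn0 : n ≠ 0 := by omega
      have key : ∀ γ : V.ValueGroup, γ ≠ 0 → α g * γ ^ p.1 = α g' * γ ^ p.2 →
          γ ^ n = α g / α g' := by
        intro γ hγ h
        rw [hn, pow_add, ← mul_assoc] at h
        have hγp : γ ^ p.1 ≠ 0 := pow_ne_zero _ hγ
        rw [eq_div_iff hα', mul_comm]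
        have h' : α g * γ ^ p.1 = α g' * γ ^ n * γ ^ p.1 := by rw [h, mul_right_comm]
        exact (mul_right_cancel₀ hγp h').symm
      have := (key γ₁ h10 h1).trans (key γ₂ h20 h2).symm
      exact (pow_left_strictMonoOn₀ hn0).injOn zero_le zero_le this
    · obtain ⟨n, hn⟩ : ∃ n, p.1 = p.2 + n := ⟨p.1 - p.2, by omega⟩
      have hn0 : n ≠ 0 := by omega
      have key : ∀ γ : V.ValueGroup, γ ≠ 0 → α g * γ ^ p.1 = α g' * γ ^ p.2 →
          γ ^ n = α g' / α g := by
        intro γ hγ h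
        rw [hn, pow_add, ← mul_assoc] at h
        have hγp : γ ^ p.2 ≠ 0 := pow_ne_zero _ hγ
        rw [eq_div_iff hα, mul_comm]
        have h' : α g * γ ^ n * γ ^ p.2 = α g' * γ ^ p.2 := by rw [← h, mul_right_comm]
        exact mul_right_cancel₀ hγp h'
      have := (key γ₁ h10 h1).trans (key γ₂ h20 h2).symm
      exact (pow_left_strictMonoOn₀ hn0).injOn zero_le zero_le this
  -- infinitely many values `v(z - a)` below `v(z - aS)`
  let vals : Set V.ValueGroup :=
    {γ | ∃ a ∈ K, V.valuation (z - a) = γ ∧ γ ≤ V.valuation (z - aS)}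
  have hvalsinf : vals.Infinite := by
    intro hfin
    have hne : vals.Nonempty := ⟨_, aS, haSK, rfl, le_rfl⟩
    obtain ⟨γ, hγ⟩ := Set.Finite.exists_minimal hfin hne
    obtain ⟨a, haK, hγa, hγle⟩ := hγ.1
    obtain ⟨a₁, ha₁K, hlt⟩ := exists_valuation_sub_lt V K hzK hval hres haK
    have hmem : V.valuation (z - a₁) ∈ vals :=
      ⟨a₁, ha₁K, rfl, (hlt.le.trans (hγa.le.trans hγle))⟩
    have := hγ.2 hmem (by rw [← hγa]; exact hlt.le)
    rw [← hγa] at this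
    exact absurd hlt (not_lt.mpr this)
  obtain ⟨γ, ⟨a, haK, hγa, hγle⟩, hγbad⟩ := (hvalsinf.sdiff hbadfin).nonempty
  obtain ⟨b, hbK, hvb⟩ := hval (z - a) (sub_mem hzE (hKE a haK)) (hza a haK)
  have hb0 : b ≠ 0 := by
    rintro rfl
    rw [map_zero] at hvb
    exact hvza a haK hvb
  refine ⟨a, haK, b, hbK, hb0, hvb.symm, ?_⟩
  intro f hf i j hij hi hj heq
  -- the Taylor coefficients are values of Hasse derivatives in `G`, of value `α`
  have hdeg : ∀ m, (taylor a f).coeff m * b ^ m ≠ 0 → m ≤ f.natDegree := by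
    intro m hm
    by_contra hlt
    have : (taylor a f).coeff m = 0 := by
      apply coeff_eq_zero_of_natDegree_lt
      rw [natDegree_taylor]
      exact not_le.mp hlt
    exact hm (by rw [this, zero_mul])
  have hmemG : ∀ m, m ≤ f.natDegree → hasseDeriv m f ∈ G := fun m hm => by
    simp only [G, Finset.mem_biUnion, Finset.mem_image]
    exact ⟨f, hf, m, Finset.mem_range.mpr (Nat.lt_succ_of_le hm), rfl⟩
  have hvalt : ∀ m, (taylor a f).coeff m * b ^ m ≠ 0 →
      V.valuation ((taylor a f).coeff m * b ^ m) = α (hasseDeriv m f) * γ ^ m ∧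
        α (hasseDeriv m f) ≠ 0 := by
    intro m hm
    have hmG := hmemG m (hdeg m hm)
    have h1 : V.valuation ((taylor a f).coeff m) = α (hasseDeriv m f) := by
      rw [taylor_coeff]
      exact hconst _ hmG a haK (by rw [hγa]; exact hγle)
    refine ⟨by rw [map_mul, map_pow, h1, ← hvb, hγa], ?_⟩
    rw [← h1]
    exact (_root_.map_ne_zero _).mpr (left_ne_zero_of_mul hm)
  obtain ⟨hvi, hαi⟩ := hvalt i hi
  obtain ⟨hvj, hαj⟩ := hvalt j hj
  have hγ0 : γ ≠ 0 := by rw [← hγa]; exact hvza a haK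
  have hdegbd : ∀ m, m ≤ f.natDegree → m ∈ Finset.range (G.sup natDegree + 2) := by
    intro m hm
    rw [Finset.mem_range]
    have : f.natDegree ≤ G.sup natDegree := by
      have h0 : hasseDeriv 0 f ∈ G := hmemG 0 (Nat.zero_le _)
      have := Finset.le_sup (f := natDegree) h0
      rwa [hasseDeriv_zero, LinearMap.id_apply] at this
    omega
  apply hγbad
  simp only [bad, Set.mem_iUnion, Set.mem_setOf_eq, Finset.mem_product]
  exact ⟨hasseDeriv i f, hmemG i (hdeg i hi), hasseDeriv j f, hmemG j (hdeg j hj), (i, j),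
    ⟨hdegbd i (hdeg i hi), hdegbd j (hdeg j hj)⟩, hγ0, hαi, hαj, hij, by rw [← hvi, ← hvj, heq]⟩

/-! ## Knaf–Kuhlmann 2009, Lemma 3.9 -/

/-- Elements of the ring `K[z] = Subring.closure (K ∪ {z})` are values at `z` of polynomials
with coefficients in `K`. [folklore] -/
theorem exists_polynomial_eval_eq_of_mem_closure {z x : Ω}
    (hx : x ∈ Subring.closure ((K : Set Ω) ∪ {z})) :
    ∃ P : Polynomial Ω, (∀ k, P.coeff k ∈ K) ∧ P.eval z = x := by
  induction hx using Subring.closure_induction with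
  | mem x hx =>
    rcases hx with hx | hx
    · refine ⟨C x, fun k => ?_, eval_C⟩
      rw [coeff_C]; split_ifs; exacts [hx, K.zero_mem]
    · rw [Set.mem_singleton_iff] at hx
      subst hx
      refine ⟨X, fun k => ?_, eval_X⟩
      rw [coeff_X]; split_ifs; exacts [K.one_mem, K.zero_mem]
  | zero => exact ⟨0, fun k => by rw [coeff_zero]; exact K.zero_mem, eval_zero⟩
  | one => exact ⟨1, fun k => by rw [coeff_one]; split_ifs; exacts [K.one_mem, K.zero_mem], eval_one⟩
  | add x y _ _ hx hy =>
    obtain ⟨P, hP, rfl⟩ := hx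
    obtain ⟨Q, hQ, rfl⟩ := hy
    exact ⟨P + Q, fun k => by rw [coeff_add]; exact add_mem (hP k) (hQ k), eval_add⟩
  | neg x _ hx =>
    obtain ⟨P, hP, rfl⟩ := hx
    exact ⟨-P, fun k => by rw [coeff_neg]; exact neg_mem (hP k), eval_neg _ _⟩
  | mul x y _ _ hx hy =>
    obtain ⟨P, hP, rfl⟩ := hx
    obtain ⟨Q, hQ, rfl⟩ := hy
    refine ⟨P * Q, fun k => ?_, eval_mul⟩
    rw [coeff_mul]
    exact sum_mem fun ij _ => mul_mem (hP _) (hQ _)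

/-- **The dominant Taylor term** (Knaf–Kuhlmann 2009, (4) of Lemma 2.18 and (10) of Lemma 3.9):
with `a, b` as in Lemma 2.18 and `z̃ := (z - a)/b`, a polynomial `f` over `K` with
`f(z) ≠ 0` factors as `f(z) = t · g(z̃)` with `t ∈ K` (the dominant term `f^{[i]}(a) bⁱ`),
`g` with coefficients in `O_K`, and `v(g(z̃)) = 0`. PROVED. [cite: KnafKuhlmann2009, Lemma 3.9 (proof)] -/
theorem exists_dominant_taylor_term {z a b : Ω} (haK : a ∈ K) (hbK : b ∈ K) (hb0 : b ≠ 0)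
    (hvb : V.valuation b = V.valuation (z - a)) {f : Polynomial Ω} (hf : ∀ k, f.coeff k ∈ K)
    (hdist : ∀ i j : ℕ, i ≠ j → (taylor a f).coeff i * b ^ i ≠ 0 →
      (taylor a f).coeff j * b ^ j ≠ 0 →
      V.valuation ((taylor a f).coeff i * b ^ i) ≠ V.valuation ((taylor a f).coeff j * b ^ j))
    (hfz : f.eval z ≠ 0) :
    ∃ t ∈ K, t ≠ 0 ∧ ∃ g : Polynomial Ω, (∀ k, g.coeff k ∈ V ∧ g.coeff k ∈ K) ∧
      f.eval z = t * g.eval ((z - a) / b) ∧ V.valuation (g.eval ((z - a) / b)) = 1 := by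
  classical
  set zt := (z - a) / b with hzt
  have hza : z - a = b * zt := by rw [hzt, mul_div_cancel₀ _ hb0]
  have hvzt : V.valuation zt = 1 := by
    have hvb0 : V.valuation b ≠ 0 := (_root_.map_ne_zero _).mpr hb0
    rw [hzt, map_div₀, ← hvb, div_self hvb0]
  set d := f.natDegree with hd
  obtain ⟨T, hT⟩ : ∃ T : ℕ → Ω, T = fun i => (taylor a f).coeff i * b ^ i := ⟨_, rfl⟩
  have hTi : ∀ i, T i = (taylor a f).coeff i * b ^ i := fun i => by rw [hT]
  have hTK : ∀ i, T i ∈ K := fun i => by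
    rw [hTi]; exact mul_mem (coeff_taylor_mem K hf haK i) (pow_mem hbK i)
  -- Taylor expansion: `f(z) = Σ T i * zt ^ i`
  have hexp : f.eval z = ∑ i ∈ Finset.range (d + 1), T i * zt ^ i := by
    have h1 : f.eval z = (taylor a f).eval (z - a) := by rw [taylor_eval, sub_add_cancel]
    rw [h1, eval_eq_sum_range, natDegree_taylor]
    refine Finset.sum_congr rfl fun i _ => ?_
    rw [hTi, hza, mul_pow, mul_assoc]
  -- the dominant index
  set I := (Finset.range (d + 1)).filter (fun i => T i ≠ 0) with hI
  have hIne : I.Nonempty := by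
    by_contra hne
    rw [Finset.not_nonempty_iff_eq_empty] at hne
    apply hfz
    rw [hexp]
    refine Finset.sum_eq_zero fun i hi => ?_
    have : ¬ (T i ≠ 0) := fun h => by
      have : i ∈ I := Finset.mem_filter.mpr ⟨hi, h⟩
      rw [hne] at this; exact Finset.notMem_empty _ this
    rw [not_not.mp this, zero_mul]
  obtain ⟨i₀, hi₀I, hmax⟩ := Finset.exists_max_image I (fun i => V.valuation (T i)) hIne
  have hi₀ : i₀ ∈ Finset.range (d + 1) := (Finset.mem_filter.mp hi₀I).1
  have hT₀ : T i₀ ≠ 0 := (Finset.mem_filter.mp hi₀I).2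
  have hvT₀ : V.valuation (T i₀) ≠ 0 := (_root_.map_ne_zero _).mpr hT₀
  have hlt : ∀ i ∈ Finset.range (d + 1), i ≠ i₀ → V.valuation (T i) < V.valuation (T i₀) := by
    intro i hi hne
    by_cases hTz : T i = 0
    · rw [hTz, map_zero]; exact zero_lt_iff.mpr hvT₀
    · refine lt_of_le_of_ne (hmax i (Finset.mem_filter.mpr ⟨hi, hTz⟩)) ?_
      have h := hdist i i₀ hne (by rw [← hTi i]; exact hTz) (by rw [← hTi i₀]; exact hT₀)
      rwa [← hTi i, ← hTi i₀] at h
  have hvsum : V.valuation (∑ i ∈ Finset.range (d + 1), T i * zt ^ i) = V.valuation (T i₀) := by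
    rw [Valuation.map_sum_eq_of_lt (j := i₀) _ hi₀]
    · rw [map_mul, map_pow, hvzt, one_pow, mul_one]
    · intro i hi
      rw [Finset.mem_sdiff, Finset.mem_singleton] at hi
      rw [map_mul, map_pow, hvzt, one_pow, mul_one, map_mul, map_pow, hvzt, one_pow, mul_one]
      exact hlt i hi.1 hi.2
  -- the normalised polynomial `g := Σ (T i / T i₀) X^i`
  set g : Polynomial Ω := ∑ i ∈ Finset.range (d + 1), C (T i / T i₀) * X ^ i with hg
  have hgcoeff : ∀ k, g.coeff k = if k ∈ Finset.range (d + 1) then T k / T i₀ else 0 := by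
    intro k
    rw [hg, finsetSum_coeff]
    simp only [coeff_C_mul_X_pow]
    rw [Finset.sum_ite_eq]
  have hgeval : g.eval zt = (∑ i ∈ Finset.range (d + 1), T i * zt ^ i) / T i₀ := by
    rw [hg, eval_finsetSum, div_eq_mul_inv, Finset.sum_mul]
    refine Finset.sum_congr rfl fun i _ => ?_
    rw [eval_mul, eval_C, eval_pow, eval_X]
    ring
  refine ⟨T i₀, hTK i₀, hT₀, g, fun k => ?_, ?_, ?_⟩
  · rw [hgcoeff]
    split_ifs with hk
    · refine ⟨(V.valuation_le_one_iff _).mp ?_, div_mem (hTK k) (hTK i₀)⟩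
      rw [map_div₀, div_le_one₀ (zero_lt_iff.mpr hvT₀)]
      by_cases hki : k = i₀
      · rw [hki]
      · exact (hlt k hk hki).le
    · exact ⟨V.zero_mem, K.zero_mem⟩
  · rw [hgeval, hexp, mul_div_cancel₀ _ hT₀]
  · rw [hgeval, map_div₀, hvsum, div_self hvT₀]

/-- **Knaf–Kuhlmann 2009, Lemma 3.9** ("Let `(K(x)|K, P)` be an immediate, transcendental
extension possessing the property (3) stated in Lemma 2.17, then `P` is strongly smoothly
`O_K`-uniformizable."; proof: for `z₁,…,z_m ∈ O_P`, `zⱼ = fⱼ(x)/gⱼ(x)`, choose `x̃ = (x-a)/b`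
by Lemma 2.18; then `zⱼ = c · f̃ⱼ(x̃)/g̃ⱼ(x̃)` with `c ∈ O_K`, `f̃ⱼ, g̃ⱼ ∈ O_K[x̃]`,
`v g̃ⱼ(x̃) = 0`, so `z₁,…,z_m ∈ O_K[x̃]_q`), ambient form: `K ⊆ Ω` a subfield, `z ∈ Ω`
transcendental over `K` with `K(z)|K` immediate (`vK(z) = vK`, `K(z)P = KP`) and satisfying
condition (3); then every finite `Z ⊆ O_V ∩ K(z)` is smoothly `O_K`-uniformizable on the
model `O_K[z̃]`, a polynomial ring (`O_K = V ∩ K`). PROVED.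
[cite: KnafKuhlmann2009, Lemma 3.9] -/
theorem isSmoothlyUniformizableIn_of_immediate_of_kaplansky {z : Ω}
    (htrans : ∀ P : Polynomial Ω, (∀ k, P.coeff k ∈ K) → P.eval z = 0 → P = 0)
    (hval : ∀ w ∈ Subfield.closure ((K : Set Ω) ∪ {z}), w ≠ 0 → ∃ b ∈ K,
      V.valuation w = V.valuation b)
    (hres : ∀ w ∈ Subfield.closure ((K : Set Ω) ∪ {z}), w ∈ V → ∃ c ∈ K,
      V.valuation (w - c) < 1)
    (h3 : ∀ g : Polynomial Ω, (∀ k, g.coeff k ∈ K) → ∃ a₀ ∈ K, ∃ α : V.ValueGroup,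
      ∀ a ∈ K, V.valuation (z - a) ≤ V.valuation (z - a₀) → V.valuation (g.eval a) = α)
    (Z : Finset Ω) (hZ : ∀ w ∈ Z, w ∈ V ∧ w ∈ Subfield.closure ((K : Set Ω) ∪ {z})) :
    IsSmoothlyUniformizableIn ↥(V.toSubring ⊓ K.toSubring) V
      (Subfield.closure ((K : Set Ω) ∪ {z})) (Z : Set Ω) := by
  classical
  set E := Subfield.closure ((K : Set Ω) ∪ {z}) with hE
  set O : Subring Ω := V.toSubring ⊓ K.toSubring with hO
  have hKE : ∀ x ∈ K, x ∈ E := fun x hx => Subfield.subset_closure (Or.inl hx)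
  have hzE : z ∈ E := Subfield.subset_closure (Or.inr rfl)
  have hzK : z ∉ K := by
    intro hzK
    have h := htrans (X - C z) (fun k => by
      rw [coeff_sub, coeff_X, coeff_C]
      split_ifs <;> first | exact sub_mem K.one_mem hzK | exact sub_mem K.one_mem K.zero_mem |
        exact sub_mem K.zero_mem hzK | exact sub_mem K.zero_mem K.zero_mem) (by simp)
    exact X_sub_C_ne_zero z h
  -- numerators and denominators of the elements of `Z`
  have hrep : ∀ w : Z, ∃ PQ : Polynomial Ω × Polynomial Ω, (∀ k, PQ.1.coeff k ∈ K) ∧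
      (∀ k, PQ.2.coeff k ∈ K) ∧ (w : Ω) = PQ.1.eval z / PQ.2.eval z := by
    intro w
    obtain ⟨p, hp, q, hq, hpq⟩ := Subfield.mem_closure_iff.mp (hZ w w.2).2
    obtain ⟨P, hP, rfl⟩ := exists_polynomial_eval_eq_of_mem_closure K hp
    obtain ⟨Q, hQ, rfl⟩ := exists_polynomial_eval_eq_of_mem_closure K hq
    exact ⟨(P, Q), hP, hQ, hpq.symm⟩
  choose PQ hP hQ hweq using hrep
  -- Lemma 2.18 for all of them
  let S : Finset (Polynomial Ω) := Finset.univ.biUnion fun w : Z => {(PQ w).1, (PQ w).2}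
  have hS : ∀ f ∈ S, ∀ k, f.coeff k ∈ K := by
    intro f hf
    simp only [S, Finset.mem_biUnion, Finset.mem_univ, true_and, Finset.mem_insert,
      Finset.mem_singleton] at hf
    obtain ⟨w, rfl | rfl⟩ := hf
    exacts [hP w, hQ w]
  obtain ⟨a, haK, b, hbK, hb0, hvb, hdist⟩ :=
    exists_center_taylor_valuation_ne V K hzK hval hres h3 S hS
  set zt := (z - a) / b with hzt
  have hza : z = b * zt + a := by rw [hzt, mul_div_cancel₀ _ hb0, sub_add_cancel]
  have hvzt : V.valuation zt = 1 := by
    have hvb0 : V.valuation b ≠ 0 := (_root_.map_ne_zero _).mpr hb0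
    rw [hzt, map_div₀, ← hvb, div_self hvb0]
  have hztV : zt ∈ V := (V.valuation_le_one_iff _).mp hvzt.le
  have hztE : zt ∈ E := div_mem (sub_mem hzE (hKE a haK)) (hKE b hbK)
  -- the model `A := O_K[zt]`
  set A : Subalgebra O Ω := Algebra.adjoin O {zt} with hA
  let VO : Subalgebra O Ω := { V.toSubring with algebraMap_mem' := fun c => c.2.1 }
  let EO : Subalgebra O Ω := { E.toSubring with algebraMap_mem' := fun c => hKE _ c.2.2 }
  have hAV' : A ≤ VO := Algebra.adjoin_le (Set.singleton_subset_iff.mpr hztV)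
  have hAV : A.toSubring ≤ V.toSubring := fun w hw => hAV' hw
  have hAE' : A ≤ EO := Algebra.adjoin_le (Set.singleton_subset_iff.mpr hztE)
  have hAE : (A : Set Ω) ⊆ E := fun w hw => hAE' hw
  have hztA : zt ∈ A := Algebra.subset_adjoin rfl
  have hOA : ∀ c : Ω, c ∈ V → c ∈ K → c ∈ A := fun c hcV hcK => A.algebraMap_mem ⟨c, hcV, hcK⟩
  -- `zt` is transcendental over `O_K`
  have hind : AlgebraicIndependent O (fun _ : Fin 1 => zt) := by
    rw [algebraicIndependent_unique_type_iff, transcendental_iff]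
    intro p hp
    by_contra hp0
    -- `zt`, hence `z = b zt + a`, is algebraic over `K`
    set P : Polynomial Ω := p.map (algebraMap O Ω) with hPdef
    have hP0 : P ≠ 0 := (Polynomial.map_ne_zero_iff Subtype.val_injective).mpr hp0
    have hPK : ∀ k, P.coeff k ∈ K := fun k => by rw [hPdef, coeff_map]; exact (p.coeff k).2.2
    have hPzt : P.eval zt = 0 := by rw [hPdef, eval_map, ← aeval_def, hp]
    obtain ⟨P', hP'⟩ : ∃ P' : Polynomial K, P'.map (algebraMap K Ω) = P :=
      (mem_lifts P).mp ((lifts_iff_coeff_lifts P).mpr fun k => ⟨⟨P.coeff k, hPK k⟩, rfl⟩)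
    have hP'0 : P' ≠ 0 := by rintro rfl; rw [Polynomial.map_zero] at hP'; exact hP0 hP'.symm
    have halgzt : IsAlgebraic K zt := ⟨P', hP'0, by rw [aeval_def, ← eval_map, hP', hPzt]⟩
    have halgz : IsAlgebraic K z := by
      rw [hza]
      exact ((isAlgebraic_algebraMap (⟨b, hbK⟩ : K)).mul halgzt).add
        (isAlgebraic_algebraMap (⟨a, haK⟩ : K))
    obtain ⟨Q', hQ'0, hQ'z⟩ := halgz
    have hQ := htrans (Q'.map (algebraMap K Ω)) (fun k => by rw [coeff_map]; exact (Q'.coeff k).2)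
      (by rw [eval_map, ← aeval_def, hQ'z])
    exact hQ'0 ((Polynomial.map_eq_zero_iff (algebraMap K Ω).injective).mp hQ)
  have hrange : Set.range (fun _ : Fin 1 => zt) = {zt} := Set.range_const
  let e : MvPolynomial (Fin 1) O ≃ₐ[O] A :=
    hind.aevalEquiv.trans (Subalgebra.equivOfEq _ _ (by rw [hrange]))
  haveI hfpA : Algebra.FinitePresentation O A := Algebra.FinitePresentation.equiv e
  haveI : Algebra.FormallySmooth O A := Algebra.FormallySmooth.of_equiv e
  -- evaluation of polynomials over `O_K` at `zt` lands in `A`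
  have hevalA : ∀ g : Polynomial Ω, (∀ k, g.coeff k ∈ V ∧ g.coeff k ∈ K) → g.eval zt ∈ A := by
    intro g hg
    rw [eval_eq_sum_range]
    exact sum_mem fun k _ => mul_mem (hOA _ (hg k).1 (hg k).2) (pow_mem hztA k)
  refine ⟨A, hAV, hAE, hfpA, fun x hx => ?_, isSmoothAt_of_formallySmooth _, fun w hw => ?_⟩
  · -- `Frac A = E`
    have hKA : ∀ c ∈ K, c ∈ Subfield.closure (A : Set Ω) := by
      intro c hcK
      by_cases hcV : c ∈ V
      · exact Subfield.subset_closure (hOA c hcV hcK)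
      · have hci : c⁻¹ ∈ V := (V.mem_or_inv_mem c).resolve_left hcV
        rw [← inv_inv c]
        exact inv_mem (Subfield.subset_closure (hOA _ hci (inv_mem hcK)))
    have hEA : E ≤ Subfield.closure (A : Set Ω) := by
      refine Subfield.closure_le.mpr ?_
      rintro y (hy | rfl)
      · exact hKA y hy
      · rw [hza]
        exact add_mem (mul_mem (hKA b hbK) (Subfield.subset_closure hztA)) (hKA a haK)
    exact exists_div_of_mem_closure A.toSubring (hEA hx)
  · -- `Z ⊆ A_q`
    set ω : Z := ⟨w, hw⟩ with hω
    have hwV : w ∈ V := (hZ w hw).1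
    by_cases hnum : (PQ ω).1.eval z = 0
    · refine ⟨0, A.zero_mem, 1, A.one_mem, map_one _, ?_⟩
      rw [div_one]
      have := hweq ω
      rw [hnum, zero_div] at this
      exact this
    by_cases hden : (PQ ω).2.eval z = 0
    · refine ⟨0, A.zero_mem, 1, A.one_mem, map_one _, ?_⟩
      rw [div_one]
      have := hweq ω
      rw [hden, div_zero] at this
      exact this
    have hPS : (PQ ω).1 ∈ S := by
      simp only [S, Finset.mem_biUnion, Finset.mem_univ, true_and, Finset.mem_insert,
        Finset.mem_singleton]
      exact ⟨ω, Or.inl rfl⟩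
    have hQS : (PQ ω).2 ∈ S := by
      simp only [S, Finset.mem_biUnion, Finset.mem_univ, true_and, Finset.mem_insert,
        Finset.mem_singleton]
      exact ⟨ω, Or.inr rfl⟩
    obtain ⟨tP, htPK, htP0, gP, hgP, hPeq, hvgP⟩ := exists_dominant_taylor_term V K haK hbK hb0
      hvb (hP ω) (hdist _ hPS) hnum
    obtain ⟨tQ, htQK, htQ0, gQ, hgQ, hQeq, hvgQ⟩ := exists_dominant_taylor_term V K haK hbK hb0
      hvb (hQ ω) (hdist _ hQS) hden
    rw [← hzt] at hPeq hvgP hQeq hvgQ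
    have hgQ0 : gQ.eval zt ≠ 0 := fun h0 => by rw [h0, map_zero] at hvgQ; exact zero_ne_one hvgQ
    have hgP0 : gP.eval zt ≠ 0 := fun h0 => by rw [h0, map_zero] at hvgP; exact zero_ne_one hvgP
    -- `c := tP / tQ ∈ O_K` since `v(c) = v(w) ≤ 1`
    set c := tP / tQ with hc
    have hw' : w = (PQ ω).1.eval z / (PQ ω).2.eval z := hweq ω
    have hwc : w = c * gP.eval zt / gQ.eval zt := by
      rw [hw', hPeq, hQeq, hc]
      field_simp
    have hvc : V.valuation c ≤ 1 := by
      have hvw : V.valuation w ≤ 1 := (V.valuation_le_one_iff w).mpr hwV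
      rw [hwc, map_div₀, map_mul, hvgP, hvgQ, mul_one, div_one] at hvw
      exact hvw
    have hcV : c ∈ V := (V.valuation_le_one_iff c).mp hvc
    have hcK : c ∈ K := div_mem htPK htQK
    exact ⟨c * gP.eval zt, mul_mem (hOA c hcV hcK) (hevalA gP hgP), gQ.eval zt, hevalA gQ hgQ,
      hvgQ, hwc⟩

end Literature.AlgebraicGeometry.Resolution

end
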